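import Literature.GroupTheory.SpecificGroups.FiniteUnitaryThreeNilpotentOrbits   -- ★ p846602 (this lineage): `eq_of_truncCayley_eq`; ⊇ ★ p845492, ★ `UnitaryThreeRegularUnipotentClass`, ★ `…UnipotentConjugacy`, ★ `UnitaryFormAdjointCayley`
import HarnessLib

/-!
# Jordan rank classifies the unipotent classes of `O₃(K)` (`char K ≠ 2`): NO rank-`1` unipotents, ONE regular class; nilpotent `Ad`-orbits in `so₃(K)` likewise
# (the finite layer of the S3-tree at a TAME-RAMIFIED place: residue group ORTHOGONAL, `σ̄ = id`)

Topic `Literature/GroupTheory/SpecificGroups`; namespace `Literature.GroupTheory.SpecificGroups`.  THEOREMS ONLY (no definition, no named fact, no instance, no notation,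
no `sorry`).  Cell `pub/hodgecm-mathlib` (crux H413 = `stmt-HodgeConjecture-24833`), «S3-ram» seeding wave (LEAD T11-41∕T11-45 (2); owner p06 (g15); seat F0P3-p03 (g14)):
at a tame-ramified non-split place `w ∣ v` of the CM field the residue field extension is TRIVIAL (`𝓀_w = 𝓀_v = 𝔽_q`, `σ̄_w = id`, census 314ef3bd §3 (E4)), so the
residual form of a self-dual vertex is a non-degenerate SYMMETRIC form and the finite layer of the (U)∕(V) organs (★ p845492 `FiniteUnitaryThreeUnipotentJordanClasses`,
★ p846602 `FiniteUnitaryThreeNilpotentOrbits`, inert: `σ̄ = Frob_q` on `𝔽_{q²}`) becomes ORTHOGONAL: the tree's `unitaryGroupOfForm (RingHom.id K) J` IS the orthogonal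
group `O(J) = {g : gᵀ J g = J}`.  THE FACTS (valid over ANY field `K` with `2 ≠ 0` — no finiteness, no Lang): in `O(J₀)`, `J₀ = antidiag(1,1,1)` (and hence in `O(c·J₀)`,
the self-dual ramified frames of ★ p846344 `exists_glInt_placeForm_eq_smul_formCongr_antidiagonal_of_neg`), (i) a unipotent `u` with `(u − 1)² = 0` is TRIVIAL — the tree's
normal form ★ `exists_conj_coe_eq_cornerUnipotent_of_sq_eq_zero` gives `u ~ n(t)` with `σ t + t = 0`, i.e. `2t = 0` for `σ = id`; so `rank(u − 1) ∈ {0, 2}` («the Jordan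
type `(2,1)` does not occur in `O₃`: even parts have even multiplicity»); (ii) the REGULAR unipotents form ONE `O(J₀)`-class — ★ `exists_conj_eq_of_regular_unipotent` (Rogawski
Prop. 3.9.1, stated in the tree for any involution `σ`, here `σ = id`; `SO₃ ≅ PGL₂` has one regular unipotent class); (iii) the same for nilpotent `N ∈ so(J₀) = {N : J₀⁻¹NᵀJ₀ = −N}`
by the truncated Cayley map `W(N) = 1 − 2N + 2N²` of ★ p846602 (generic in `σ`, re-run here): no rank-`1` skew nilpotents, one regular orbit.
HONEST LABEL: HC_CM is proved only modulo the printed citations (the 2 remaining named inputs hLiu418, h413) until rung 0 closes; this file is elementary linear algebra and asserts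
nothing about the `p`-adic groups; it is certificate-independent capital for the ramified column (B-p14 (g37)'s RIGID-ram certificate, p08 (g18)'s (r1) twin may import it).

THE PRINT. [Rogawski1990, §3.9 p. 32, Prop. 3.9.1] (regular unipotent class of `U(3)`, any `E∕F` incl. `E = F ⊕ F`… here read for the split form with trivial involution);
[Wilson2009, §3.7.1–§3.7.2 pp. 69–72] (`Ω₃(q) ≅ PSL₂(q)`, `SO₃(q) ≅ PGL₂(q)`; unipotent elements of orthogonal groups in odd characteristic); [Weyl1939, Ch. II §10] (Cayley).

* §0 `mem_unitaryGroupOfForm_smul_iff` — `U(σ, c·J) = U(σ, J)` for `c ≠ 0` (ramified residual forms arrive as `c̄·J₀`);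
* §1 **`eq_one_of_mem_orthogonal_of_sq_sub_one_eq_zero`** (`(u − 1)² = 0 ⇒ u = 1` in `O(J₀)`), **`rank_sub_one_ne_one_of_mem_orthogonal`**;
* §2 **`exists_conj_eq_of_rank_sub_one_eq_of_orthogonal`** — MAIN: unipotent `u, u′ ∈ O(J₀)` with `rank(u − 1) = rank(u′ − 1)` are `O(J₀)`-conjugate; `eq_of_conj_invariant_of_rank_eq_of_orthogonal`;
* §3 `exists_mem_unitaryGroupOfForm_truncCayley` (any `σ`, `J`: `W(N) ∈ U(σ,J)`, unipotent, `rank(W − 1) = rank N`), **`rank_ne_one_of_skew_of_pow_three_eq_zero`**,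
  **`exists_orthogonal_conj_eq_of_pow_three_eq_zero_of_rank_eq`** (nilpotent `Ad O(J₀)`-orbits in `so(J₀)` by rank).

## References
* [Rogawski1990] J. D. Rogawski, *Automorphic Representations of Unitary Groups in Three Variables*, Ann. of Math. Stud. 123 (1990): §3.9 p. 32, Proposition 3.9.1.
* [Wilson2009] R. A. Wilson, *The Finite Simple Groups*, GTM 251 (2009): §3.7.1–§3.7.2 pp. 69–72.
* [Weyl1939] H. Weyl, *The Classical Groups* (1939): Ch. II §10.
-/

set_option autoImplicit false

noncomputable section

open Matrix Literature.NumberTheory.Automorphic Literature.NumberTheory.Automorphic.UnitaryGroup Literature.NumberTheory.Automorphic.HermitianLattice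
open Literature.LinearAlgebra.Matrix

namespace Literature.GroupTheory.SpecificGroups

variable {K : Type*} [Field K]

/-! ### §0 Scaling the form does not change the group -/

/-- `U(σ, c·J) = U(σ, J)` for `c ≠ 0` (any `σ`). [cite: Wilson2009, §3.7.1 p. 69] -/
theorem mem_unitaryGroupOfForm_smul_iff (σ : K →+* K) {n : Type*} [Fintype n] [DecidableEq n] (J : Matrix n n K) {c : K} (hc : c ≠ 0) (g : GL n K) :
    g ∈ unitaryGroupOfForm σ (c • J) ↔ g ∈ unitaryGroupOfForm σ J := by
  rw [mem_unitaryGroupOfForm_iff, mem_unitaryGroupOfForm_iff, Matrix.mul_smul, Matrix.smul_mul]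
  exact (smul_right_injective _ hc).eq_iff

/-! ### §1 No Jordan type `(2,1)` in `O₃`: `(u − 1)² = 0 ⇒ u = 1` -/

/-- **In `O(J₀)` (`σ = id`, `2 ≠ 0`) a unipotent with `(u − 1)² = 0` is trivial**: the tree's normal form `u ~ n(t)` has `σ t + t = 0`, i.e. `2t = 0`.
[cite: Wilson2009, §3.7.2 p. 71] [cite: Rogawski1990, §3.9 p. 32] -/
theorem eq_one_of_mem_orthogonal_of_sq_sub_one_eq_zero (h2 : (2 : K) ≠ 0) {u : GL (Fin 3) K}
    (hu : u ∈ unitaryGroupOfForm (RingHom.id K) ((StdForm.antidiagonal 3).over K))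
    (hsq : ((u : Matrix (Fin 3) (Fin 3) K) - 1) * ((u : Matrix (Fin 3) (Fin 3) K) - 1) = 0) : u = 1 := by
  obtain ⟨k, -, t, ht, hkt⟩ := exists_conj_coe_eq_cornerUnipotent_of_sq_eq_zero (RingHom.id K) (fun _ => rfl) hu hsq
  have ht0 : t = 0 := by
    rw [RingHom.id_apply, ← two_mul] at ht
    exact (mul_eq_zero.1 ht).resolve_left h2
  have h1 : k * u * k⁻¹ = 1 := by
    ext i j
    rw [hkt, ht0, Units.val_one]
    fin_cases i <;> fin_cases j <;> simp
  calc u = k⁻¹ * (k * u * k⁻¹) * k := by group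
    _ = 1 := by rw [h1]; group

/-- **`rank(u − 1) ≠ 1` for a unipotent `u ∈ O(J₀)`** (`2 ≠ 0`): the Jordan rank of an orthogonal unipotent of degree `3` is `0` or `2`. [cite: Wilson2009, §3.7.2 p. 71] -/
theorem rank_sub_one_ne_one_of_mem_orthogonal (h2 : (2 : K) ≠ 0) {u : GL (Fin 3) K}
    (hu : u ∈ unitaryGroupOfForm (RingHom.id K) ((StdForm.antidiagonal 3).over K)) (hnil : IsNilpotent ((u : Matrix (Fin 3) (Fin 3) K) - 1)) :
    ((u : Matrix (Fin 3) (Fin 3) K) - 1).rank ≠ 1 := by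
  intro h1
  obtain ⟨hne, hsq⟩ := (rank_eq_one_iff_of_isNilpotent hnil).1.1 h1
  exact hne (by rw [eq_one_of_mem_orthogonal_of_sq_sub_one_eq_zero h2 hu hsq, Units.val_one, sub_self])

/-! ### §2 Jordan rank classifies the unipotent classes of `O(J₀)` -/

/-- **MAIN: unipotent `u, u′ ∈ O(J₀)` (`σ = id`, `2 ≠ 0`, ANY field) with `rank(u − 1) = rank(u′ − 1)` are `O(J₀)`-conjugate**: rank `0` ⇒ both are `1`; rank `1` does not occur
(§1); rank `2` = regular ⇒ ★ `exists_conj_eq_of_regular_unipotent` (Rogawski Prop. 3.9.1 with the trivial involution). [cite: Rogawski1990, §3.9 p. 32, Prop. 3.9.1]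
[cite: Wilson2009, §3.7.2 p. 71] -/
theorem exists_conj_eq_of_rank_sub_one_eq_of_orthogonal (h2 : (2 : K) ≠ 0) {u u' : GL (Fin 3) K}
    (hu : u ∈ unitaryGroupOfForm (RingHom.id K) ((StdForm.antidiagonal 3).over K))
    (hu' : u' ∈ unitaryGroupOfForm (RingHom.id K) ((StdForm.antidiagonal 3).over K))
    (hnil : IsNilpotent ((u : Matrix (Fin 3) (Fin 3) K) - 1)) (hnil' : IsNilpotent ((u' : Matrix (Fin 3) (Fin 3) K) - 1))
    (hrank : ((u : Matrix (Fin 3) (Fin 3) K) - 1).rank = ((u' : Matrix (Fin 3) (Fin 3) K) - 1).rank) :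
    ∃ g : GL (Fin 3) K, g ∈ unitaryGroupOfForm (RingHom.id K) ((StdForm.antidiagonal 3).over K) ∧ g * u * g⁻¹ = u' := by
  by_cases hsq : ((u : Matrix (Fin 3) (Fin 3) K) - 1) * ((u : Matrix (Fin 3) (Fin 3) K) - 1) = 0
  · -- `u = 1`, and then `rank(u′ − 1) = 0` forces `u′ = 1`
    have hu1 := eq_one_of_mem_orthogonal_of_sq_sub_one_eq_zero h2 hu hsq
    have hr0 : ((u' : Matrix (Fin 3) (Fin 3) K) - 1).rank = 0 := by rw [← hrank, hu1, Units.val_one, sub_self, Matrix.rank_zero]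
    have hu'1 : u' = 1 := by
      have h0 := (rank_eq_zero_iff_eq_zero _).1 hr0
      exact Units.ext (sub_eq_zero.1 h0)
    exact ⟨1, one_mem _, by rw [hu1, hu'1]; group⟩
  · -- both regular
    have h2r : ((u : Matrix (Fin 3) (Fin 3) K) - 1).rank = 2 := (rank_eq_one_iff_of_isNilpotent hnil).2.2 hsq
    have hsq' : ((u' : Matrix (Fin 3) (Fin 3) K) - 1) * ((u' : Matrix (Fin 3) (Fin 3) K) - 1) ≠ 0 :=
      (rank_eq_one_iff_of_isNilpotent hnil').2.1 (by rw [← hrank, h2r])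
    exact exists_conj_eq_of_regular_unipotent (RingHom.id K) (fun _ => rfl) h2 hu hu' hnil hnil' hsq hsq'

/-- **A conjugation-invariant function on `O(J₀)` takes equal values on unipotents of equal Jordan rank** (the (U)-ram socket shape). [cite: Rogawski1990, §3.9 p. 32, Prop. 3.9.1] -/
theorem eq_of_conj_invariant_of_rank_eq_of_orthogonal (h2 : (2 : K) ≠ 0) {α : Type*} (f : GL (Fin 3) K → α)
    (hf : ∀ g ∈ unitaryGroupOfForm (RingHom.id K) ((StdForm.antidiagonal 3).over K), ∀ x ∈ unitaryGroupOfForm (RingHom.id K) ((StdForm.antidiagonal 3).over K),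
      f (g * x * g⁻¹) = f x)
    {u u' : GL (Fin 3) K} (hu : u ∈ unitaryGroupOfForm (RingHom.id K) ((StdForm.antidiagonal 3).over K))
    (hu' : u' ∈ unitaryGroupOfForm (RingHom.id K) ((StdForm.antidiagonal 3).over K))
    (hnil : IsNilpotent ((u : Matrix (Fin 3) (Fin 3) K) - 1)) (hnil' : IsNilpotent ((u' : Matrix (Fin 3) (Fin 3) K) - 1))
    (hrank : ((u : Matrix (Fin 3) (Fin 3) K) - 1).rank = ((u' : Matrix (Fin 3) (Fin 3) K) - 1).rank) : f u = f u' := by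
  obtain ⟨g, hg, hconj⟩ := exists_conj_eq_of_rank_sub_one_eq_of_orthogonal h2 hu hu' hnil hnil' hrank
  rw [← hconj, hf g hg u hu]

/-! ### §3 The nilpotent `Ad`-orbits in `so(J₀)` (truncated Cayley map, generic in `σ`) -/

/-- **The truncated Cayley value is unitary, unipotent, of the same rank** (any `σ`, any `J` with unit determinant, `2 ≠ 0`): for `θ_J X = −X` and `X³ = 0`,
`W(X) = 1 − 2X + 2X² ∈ U(σ, J)`, `W − 1` is nilpotent and `rank(W − 1) = rank X` (the `key` step of ★ p846602, stated on its own). [cite: Weyl1939, Ch. II §10] -/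
theorem exists_mem_unitaryGroupOfForm_truncCayley (σ : K →+* K) (h2 : (2 : K) ≠ 0) {J : Matrix (Fin 3) (Fin 3) K} (hJu : IsUnit J.det)
    {X : Matrix (Fin 3) (Fin 3) K} (hX : J⁻¹ * (X.map σ)ᵀ * J = -X) (hX3 : X * X * X = 0) :
    ∃ u : GL (Fin 3) K, u ∈ unitaryGroupOfForm σ J ∧ (u : Matrix (Fin 3) (Fin 3) K) = 1 - (X + X) + (X + X) * X ∧
      IsNilpotent ((u : Matrix (Fin 3) (Fin 3) K) - 1) ∧ ((u : Matrix (Fin 3) (Fin 3) K) - 1).rank = X.rank := by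
  have hθ : J⁻¹ * ((1 - (X + X) + (X + X) * X).map σ)ᵀ * J = 1 + (X + X) + X * (X + X) := by
    rw [formAdjoint_add, formAdjoint_sub, formAdjoint_one σ hJu, formAdjoint_mul σ hJu, formAdjoint_add, hX]
    noncomm_ring
  have hW : J⁻¹ * ((1 - (X + X) + (X + X) * X).map σ)ᵀ * J * (1 - (X + X) + (X + X) * X) = 1 := by
    rw [hθ]
    have e : (1 + (X + X) + X * (X + X)) * (1 - (X + X) + (X + X) * X) = 1 + 4 • (X * X * X * X) := by noncomm_ring
    rw [e, hX3, Matrix.zero_mul, smul_zero, add_zero]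
  obtain ⟨u, hu, huW⟩ := exists_mem_unitaryGroupOfForm_coe_eq σ hJu hW
  have hu1 : (u : Matrix (Fin 3) (Fin 3) K) - 1 = X * ((2 : K) • (X - 1)) := by
    rw [huW, Matrix.mul_smul, two_smul]; noncomm_ring
  have hcomm : Commute X ((2 : K) • (X - 1)) := ((Commute.refl X).sub_right (Commute.one_right X)).smul_right _
  have hXnil : IsNilpotent X := ⟨3, by rw [pow_succ, pow_two, hX3]⟩
  have hPu : IsUnit ((2 : K) • (X - 1)).det := by
    rw [Matrix.det_smul, Fintype.card_fin]
    refine (IsUnit.pow _ (isUnit_iff_ne_zero.2 h2)).mul ?_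
    rw [← Matrix.isUnit_iff_isUnit_det]
    have h1 : X - 1 = -(1 - X) := by abel
    rw [h1]
    exact hXnil.isUnit_one_sub.neg
  refine ⟨u, hu, huW, ?_, ?_⟩
  · rw [hu1]; exact hcomm.isNilpotent_mul_right hXnil
  · rw [hu1]; exact Matrix.rank_mul_eq_left_of_isUnit_det _ _ hPu

/-- **No rank-`1` skew nilpotents in `so(J₀)`** (`σ = id`, `2 ≠ 0`): `J₀⁻¹ Nᵀ J₀ = −N`, `N³ = 0` ⇒ `rank N ≠ 1`. [cite: Wilson2009, §3.7.2 p. 71] [cite: Weyl1939, Ch. II §10] -/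
theorem rank_ne_one_of_skew_of_pow_three_eq_zero (h2 : (2 : K) ≠ 0) {N : Matrix (Fin 3) (Fin 3) K}
    (hN : ((StdForm.antidiagonal 3).over K)⁻¹ * (N.map (RingHom.id K))ᵀ * ((StdForm.antidiagonal 3).over K) = -N) (hnil : N ^ 3 = 0) : N.rank ≠ 1 := by
  have hJu : IsUnit ((StdForm.antidiagonal 3).over K).det := (Matrix.isUnit_iff_isUnit_det _).1 ((StdForm.antidiagonal 3).isUnit_over K)
  have hN3 : N * N * N = 0 := by rw [← hnil, pow_succ, pow_two]
  obtain ⟨u, hu, -, hun, hur⟩ := exists_mem_unitaryGroupOfForm_truncCayley (RingHom.id K) h2 hJu hN hN3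
  rw [← hur]
  exact rank_sub_one_ne_one_of_mem_orthogonal h2 hu hun

/-- **Nilpotent `Ad O(J₀)`-orbits in `so(J₀)` are classified by the rank** (`σ = id`, `2 ≠ 0`, ANY field): `N, N′` skew (`J₀⁻¹ Nᵀ J₀ = −N`), cube-zero, of equal rank ⇒
`g N g⁻¹ = N′` for some `g ∈ O(J₀)` — the truncated Cayley transport of ★ p846602 over §2. [cite: Weyl1939, Ch. II §10] [cite: Rogawski1990, §3.9 p. 32, Prop. 3.9.1] -/
theorem exists_orthogonal_conj_eq_of_pow_three_eq_zero_of_rank_eq (h2 : (2 : K) ≠ 0) {N N' : Matrix (Fin 3) (Fin 3) K}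
    (hN : ((StdForm.antidiagonal 3).over K)⁻¹ * (N.map (RingHom.id K))ᵀ * ((StdForm.antidiagonal 3).over K) = -N)
    (hN' : ((StdForm.antidiagonal 3).over K)⁻¹ * (N'.map (RingHom.id K))ᵀ * ((StdForm.antidiagonal 3).over K) = -N')
    (hnil : N ^ 3 = 0) (hnil' : N' ^ 3 = 0) (hrank : N.rank = N'.rank) :
    ∃ g : GL (Fin 3) K, g ∈ unitaryGroupOfForm (RingHom.id K) ((StdForm.antidiagonal 3).over K) ∧
      (g : Matrix (Fin 3) (Fin 3) K) * N * ((g⁻¹ : GL (Fin 3) K) : Matrix (Fin 3) (Fin 3) K) = N' := by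
  have hJu : IsUnit ((StdForm.antidiagonal 3).over K).det := (Matrix.isUnit_iff_isUnit_det _).1 ((StdForm.antidiagonal 3).isUnit_over K)
  have hN3 : N * N * N = 0 := by rw [← hnil, pow_succ, pow_two]
  have hN3' : N' * N' * N' = 0 := by rw [← hnil', pow_succ, pow_two]
  obtain ⟨u, hu, huW, hun, hur⟩ := exists_mem_unitaryGroupOfForm_truncCayley (RingHom.id K) h2 hJu hN hN3
  obtain ⟨u', hu', huW', hun', hur'⟩ := exists_mem_unitaryGroupOfForm_truncCayley (RingHom.id K) h2 hJu hN' hN3'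
  obtain ⟨g, hg, hconj⟩ := exists_conj_eq_of_rank_sub_one_eq_of_orthogonal h2 hu hu' hun hun' (by rw [hur, hur', hrank])
  refine ⟨g, hg, ?_⟩
  set G : Matrix (Fin 3) (Fin 3) K := (g : Matrix (Fin 3) (Fin 3) K) with hGdef
  set Gi : Matrix (Fin 3) (Fin 3) K := ((g⁻¹ : GL (Fin 3) K) : Matrix (Fin 3) (Fin 3) K) with hGidef
  have hGiG : Gi * G = 1 := by rw [hGdef, hGidef, ← Units.val_mul, inv_mul_cancel, Units.val_one]
  have hGGi : G * Gi = 1 := by rw [hGdef, hGidef, ← Units.val_mul, mul_inv_cancel, Units.val_one]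
  have hM2 : G * N * Gi * (G * N * Gi) = G * (N * N) * Gi := by
    calc G * N * Gi * (G * N * Gi) = G * N * (Gi * G) * N * Gi := by simp only [Matrix.mul_assoc]
      _ = G * (N * N) * Gi := by rw [hGiG, Matrix.mul_one, Matrix.mul_assoc G N N]
  have hM3 : G * N * Gi * (G * N * Gi) * (G * N * Gi) = 0 := by
    rw [hM2]
    calc G * (N * N) * Gi * (G * N * Gi) = G * (N * N) * (Gi * G) * N * Gi := by simp only [Matrix.mul_assoc]
      _ = 0 := by rw [hGiG, Matrix.mul_one, Matrix.mul_assoc G (N * N) N, hN3, Matrix.mul_zero, Matrix.zero_mul]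
  have hWconj : G * (1 - (N + N) + (N + N) * N) * Gi = 1 - (G * N * Gi + G * N * Gi) + (G * N * Gi + G * N * Gi) * (G * N * Gi) := by
    have e : (G * N * Gi + G * N * Gi) * (G * N * Gi) = G * N * Gi * (G * N * Gi) + G * N * Gi * (G * N * Gi) := by noncomm_ring
    rw [e, hM2]
    have e2 : G * (1 - (N + N) + (N + N) * N) * Gi = G * Gi - (G * N * Gi + G * N * Gi) + (G * (N * N) * Gi + G * (N * N) * Gi) := by noncomm_ring
    rw [e2, hGGi]
  have hc : (((g * u * g⁻¹ : GL (Fin 3) K)) : Matrix (Fin 3) (Fin 3) K) = (u' : Matrix (Fin 3) (Fin 3) K) := by rw [hconj]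
  rw [Units.val_mul, Units.val_mul, huW, huW', ← hGdef, ← hGidef, hWconj] at hc
  exact eq_of_truncCayley_eq h2 hM3 hN3' hc

end Literature.GroupTheory.SpecificGroups

end
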